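import Literature.Probability.Percolation.MarkedLoopHolomorphy
import Literature.Probability.Percolation.TriMarkedDomainRotate
import Mathlib.Logic.Equiv.Fin.Rotate
import HarnessLib

/-!
# The tripod law and the `k`-disorder observables under rotation of the marks

Topic `Literature/Probability/Percolation`; generic-`k` layer, a rider on `MarkedLoopHolomorphy.lean` (HOLO-K: the TRIPOD LAW `TripodLaw` for class
weights `wt (partner) (link relation)`, tripod pictures `TripodPicture` over the anticlockwise cyclic order `CcwTriple` / `CcwQuad`, the class-weighted
`k`-disorder observable `ObsW`, ★ `holomorphicW_of_tripodLaw`, the FAN weight `fanWt l` with `tripodLaw_fan`) and on `TriMarkedDomainRotate.lean`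
(the ROTATED domain `D.rotate` of a `k`-marked domain, `k ≥ 2`: `rotate_yc`, `rotate_TXb`, `rotate_inClassX`, `rotate_allSides`). Khristoforov–Smirnov
index the marks «cyclically, in the counterclockwise order»; the tripod law is stated through that cyclic order only, so it is invariant under every
CYCLIC SYMMETRY of the labels, and rotating the DOMAIN is the same as rotating the WEIGHT. HOLO-K's header lists «the fan (with its rotations)» as
solutions for every odd `k`; the rotations are made theorems here.

## Content (every `k`)
* `IsCyc σ` — a permutation of `Fin k` preserving anticlockwise triples; `IsCyc.symm/trans`, `ccwQuad_iff_ccwTriple`, `IsCyc.quad`; the rotation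
  `rot k = finRotate k` (`i ↦ i + 1`), `val_rot`, ★ `isCyc_rot`, `isCyc_rot_pow`, `val_rot_pow`.
* `relMap σ L` (image relation; `mem_relMap`, `relMap_withPair`, `relMap_trans`, `relMap_symm_relMap`), ★ `TripodPicture.map` — tripod pictures are
  transported by cyclic symmetries; `rotW σ wt = (j, L) ↦ wt (σ j) (σ L)`, ★★ `tripodLaw_rotW` / `tripodLaw_rotW_iff` — THE TRIPOD LAW IS INVARIANT
  UNDER CYCLIC SYMMETRIES OF THE MARKS; `holomorphicW_rotW` (so every transported tripod-law weight gives a discretely holomorphic observable on every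
  domain); ★ `tripodLaw_rotW_fanWt` / `holomorphicW_rotW_fanWt` — THE ROTATED FANS: for `k = 2l+1` and every `r`, the weight
  `(j, L) ↦ fanWt l (j + r) (L + r)` obeys the tripod law, hence its observable is discretely holomorphic on every `(2l+1)`-marked domain.
* ★★ ROTATING THE DOMAIN IS ROTATING THE WEIGHT (`k ≥ 2`): `linkRel_rotate` (`linkRel D.rotate ξ = rot⁻¹ (linkRel D ξ)`), `gkW_rotate`,
  ★★ `obsW_rotate` (`ObsW D.rotate wt v i = ObsW D (rotW rot⁻¹ wt) v i`), `holomorphicW_rotate_iff`.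

Not claimed: anything about which weights obey the law (that is `MarkedLoopTripodBasis`), any boundary statement, any continuum limit.

## References
* M. Khristoforov, S. Smirnov, *Percolation and O(1) loop model*, arXiv:2111.15612 (2021), §1.2 (arXiv v1 p. 2: marked points «go in the
  counterclockwise order and are indexed cyclically»; «IP(ξ) is a union of disjoint paths, matching marked points»), §2 Definition 3 (p. 4:
  `u₁, u₂, u₃` in counterclockwise order) and Lemma 4 with its proof and Fig. 3 (p. 4), Remark 6 (p. 5).
* B. Bollobás, O. Riordan, *Percolation*, CUP (2006), Ch. 7 §7.2.2 (pp. 191–195: marked discrete domains), §7.2.3 p. 197 (re-marking by relabelling; verbatim «follow by relabelling the domain», §7.2.4, proof of Lemma 13).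

## Mathlib / tree
Mathlib: `finRotate`, `coe_finRotate`, `finRotate_apply`, `finRotate_symm_apply`, `Finset.mem_map_equiv`, `Equiv.prodCongr`, `Equiv.sum_comp`.
Tree: `MarkedLoopHolomorphy` (`CcwTriple`, `CcwQuad`, `TripodPicture`, `TripodLaw`, `withPair`, `mem_withPair`, `linkRel`, `mem_linkRel`, `GkW`, `ObsW`,
`HolomorphicW`, `holomorphicW_of_tripodLaw`, `fanWt`, `tripodLaw_fan`), `TriMarkedDomainRotate` (`rotate_yc`, `rotate_TXb`, `rotate_inClassX`, `rotate_allSides`).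
-/

open Finset

namespace Literature.Probability.Percolation.MarkedLoops

open Literature.Probability.Percolation.FivePoint (tau)

/-! ### Cyclic symmetries of the corner labels -/

section Cyclic

variable {nm : ℕ}

/-- **a CYCLIC SYMMETRY of the corner labels**: a permutation of `Fin k` preserving the anticlockwise cyclic order of triples (the
rotations `i ↦ i + r`). [cite: KhristoforovSmirnov2021, §1.2 (arXiv v1 p. 2: marked points «go in the counterclockwise order and are indexed cyclically»)] -/
def IsCyc (σ : Equiv.Perm (Fin nm)) : Prop := ∀ a b c : Fin nm, CcwTriple (σ a) (σ b) (σ c) ↔ CcwTriple a b c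

/-- the inverse of a cyclic symmetry is cyclic. [cite: KhristoforovSmirnov2021, §1.2 (arXiv v1 p. 2)] -/
theorem IsCyc.symm {σ : Equiv.Perm (Fin nm)} (h : IsCyc σ) : IsCyc σ.symm := fun a b c => by
  rw [← h (σ.symm a) (σ.symm b) (σ.symm c), σ.apply_symm_apply, σ.apply_symm_apply, σ.apply_symm_apply]

/-- composites of cyclic symmetries are cyclic. [cite: KhristoforovSmirnov2021, §1.2 (arXiv v1 p. 2)] -/
theorem IsCyc.trans {σ ρ : Equiv.Perm (Fin nm)} (hσ : IsCyc σ) (hρ : IsCyc ρ) : IsCyc (σ.trans ρ) := fun a b c => by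
  rw [Equiv.trans_apply, Equiv.trans_apply, Equiv.trans_apply, hρ, hσ]

/-- the identity is cyclic. [cite: KhristoforovSmirnov2021, §1.2 (arXiv v1 p. 2)] -/
theorem isCyc_refl : IsCyc (Equiv.refl (Fin nm)) := fun _ _ _ => Iff.rfl

/-- an anticlockwise quadruple is two anticlockwise triples with a common first entry. [cite: KhristoforovSmirnov2021, §1.2 (arXiv v1 p. 2)] -/
theorem ccwQuad_iff_ccwTriple {a b c d : Fin nm} : CcwQuad a b c d ↔ CcwTriple a b c ∧ CcwTriple a c d := by
  unfold CcwQuad CcwTriple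
  simp only [Fin.lt_def]
  omega

/-- cyclic symmetries preserve anticlockwise quadruples. [cite: KhristoforovSmirnov2021, §1.2 (arXiv v1 p. 2)] -/
theorem IsCyc.quad {σ : Equiv.Perm (Fin nm)} (h : IsCyc σ) (a b c d : Fin nm) :
    CcwQuad (σ a) (σ b) (σ c) (σ d) ↔ CcwQuad a b c d := by
  rw [ccwQuad_iff_ccwTriple, ccwQuad_iff_ccwTriple, h, h]

variable (nm) in
/-- **the ROTATION of the corner labels** `i ↦ i + 1 (mod k)` (Mathlib's `finRotate`; on `Fin (n+1)` it is `i ↦ i + 1`).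
[cite: KhristoforovSmirnov2021, §1.2 (arXiv v1 p. 2: cyclic indexing); §2 Definition 3 (p. 4: `u₁, u₂, u₃` in counterclockwise order)] -/
abbrev rot : Equiv.Perm (Fin nm) := finRotate nm

/-- the value of a rotated label. [cite: KhristoforovSmirnov2021, §1.2 (arXiv v1 p. 2: counterclockwise cyclic indexing)] -/
theorem val_rot (i : Fin nm) : ((rot nm i : Fin nm) : ℕ) = if i.val + 1 = nm then 0 else i.val + 1 := by
  cases nm with
  | zero => exact i.elim0
  | succ n =>
    rw [show (rot (n + 1) i : Fin (n + 1)) = finRotate (n + 1) i from rfl, coe_finRotate]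
    by_cases h : i = Fin.last n
    · rw [if_pos h, if_pos (by rw [h, Fin.val_last])]
    · rw [if_neg h, if_neg (fun e => h (Fin.ext (by rw [Fin.val_last]; omega)))]

/-- ★ the rotation is a cyclic symmetry. [cite: KhristoforovSmirnov2021, §1.2 (arXiv v1 p. 2)] -/
theorem isCyc_rot : IsCyc (rot nm) := fun a b c => by
  unfold CcwTriple
  simp only [Fin.lt_def, val_rot]
  have ha := a.2; have hb := b.2; have hc := c.2
  split_ifs <;> omega

/-- the powers of the rotation are cyclic symmetries. [cite: KhristoforovSmirnov2021, §1.2 (arXiv v1 p. 2)] -/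
theorem isCyc_rot_pow (r : ℕ) : IsCyc (rot nm ^ r) := by
  induction r with
  | zero => intro a b c; rw [pow_zero]; exact Iff.rfl
  | succ r ih => intro a b c; rw [pow_succ, Equiv.Perm.mul_apply, Equiv.Perm.mul_apply, Equiv.Perm.mul_apply, ih, isCyc_rot]

/-- the value of an `r`-fold rotated label. [cite: KhristoforovSmirnov2021, §1.2 (arXiv v1 p. 2: counterclockwise cyclic indexing)] -/
theorem val_rot_pow (r : ℕ) (i : Fin nm) : (((rot nm ^ r) i : Fin nm) : ℕ) = (i.val + r) % nm := by
  induction r with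
  | zero => rw [pow_zero, Equiv.Perm.one_apply, Nat.add_zero, Nat.mod_eq_of_lt i.2]
  | succ r ih =>
    rw [pow_succ', Equiv.Perm.mul_apply, val_rot, ih]
    have hn : 0 < nm := Nat.lt_of_le_of_lt (Nat.zero_le _) i.2
    have hlt : (i.val + r) % nm < nm := Nat.mod_lt _ hn
    obtain ⟨q, hq⟩ : ∃ q, i.val + r = (i.val + r) % nm + nm * q := ⟨(i.val + r) / nm, (Nat.mod_add_div _ _).symm⟩
    rw [show i.val + (r + 1) = ((i.val + r) % nm + 1) + nm * q by omega, Nat.add_mul_mod_self_left]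
    split_ifs with h
    · rw [h, Nat.mod_self]
    · exact (Nat.mod_eq_of_lt (by omega)).symm

end Cyclic

/-! ### Transport of relations, pictures and the tripod law along a cyclic symmetry -/

section Transport

variable {nm : ℕ}

/-- the image of a relation on the corners under a permutation of the labels. [cite: KhristoforovSmirnov2021, §1.2 (arXiv v1 p. 2: the link pattern as a matching of marked points)] -/
def relMap (σ : Equiv.Perm (Fin nm)) (L : Finset (Fin nm × Fin nm)) : Finset (Fin nm × Fin nm) :=
  L.map (Equiv.prodCongr σ σ).toEmbedding

/-- membership in the image relation. [cite: KhristoforovSmirnov2021, §1.2 (arXiv v1 p. 2)] -/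
theorem mem_relMap {σ : Equiv.Perm (Fin nm)} {L : Finset (Fin nm × Fin nm)} {a b : Fin nm} :
    (a, b) ∈ relMap σ L ↔ (σ.symm a, σ.symm b) ∈ L := by
  unfold relMap
  rw [Finset.mem_map_equiv]
  rfl

/-- membership in the image relation, forward form. [cite: KhristoforovSmirnov2021, §1.2 (arXiv v1 p. 2)] -/
theorem mem_relMap_apply {σ : Equiv.Perm (Fin nm)} {L : Finset (Fin nm × Fin nm)} {a b : Fin nm} :
    (σ a, σ b) ∈ relMap σ L ↔ (a, b) ∈ L := by
  rw [mem_relMap, σ.symm_apply_apply, σ.symm_apply_apply]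

/-- membership in the image relation, pair form. [cite: KhristoforovSmirnov2021, §1.2 (arXiv v1 p. 2)] -/
theorem mem_relMap' {σ : Equiv.Perm (Fin nm)} {L : Finset (Fin nm × Fin nm)} {cd : Fin nm × Fin nm} :
    cd ∈ relMap σ L ↔ (σ.symm cd.1, σ.symm cd.2) ∈ L := mem_relMap

/-- the image relation under the identity. [cite: KhristoforovSmirnov2021, §1.2 (arXiv v1 p. 2: counterclockwise cyclic indexing)] -/
theorem relMap_refl (L : Finset (Fin nm × Fin nm)) : relMap (Equiv.refl _) L = L := by
  ext ⟨a, b⟩; rw [mem_relMap]; rfl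

/-- the image relation under a composite. [cite: KhristoforovSmirnov2021, §1.2 (arXiv v1 p. 2: counterclockwise cyclic indexing)] -/
theorem relMap_trans (σ ρ : Equiv.Perm (Fin nm)) (L : Finset (Fin nm × Fin nm)) :
    relMap (σ.trans ρ) L = relMap ρ (relMap σ L) := by
  ext ⟨a, b⟩; rw [mem_relMap, mem_relMap, mem_relMap]; rfl

/-- the inverse symmetry undoes the image. [cite: KhristoforovSmirnov2021, §1.2 (arXiv v1 p. 2: counterclockwise cyclic indexing)] -/
theorem relMap_symm_relMap (σ : Equiv.Perm (Fin nm)) (L : Finset (Fin nm × Fin nm)) : relMap σ.symm (relMap σ L) = L := by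
  rw [← relMap_trans, Equiv.self_trans_symm, relMap_refl]

/-- the symmetry undoes the inverse image. [cite: KhristoforovSmirnov2021, §1.2 (arXiv v1 p. 2: counterclockwise cyclic indexing)] -/
theorem relMap_relMap_symm (σ : Equiv.Perm (Fin nm)) (L : Finset (Fin nm × Fin nm)) : relMap σ (relMap σ.symm L) = L := by
  rw [← relMap_trans, Equiv.symm_trans_self, relMap_refl]

/-- the image of `withPair`. [cite: KhristoforovSmirnov2021, §1.2 (arXiv v1 p. 2)] -/
theorem relMap_withPair (σ : Equiv.Perm (Fin nm)) (L : Finset (Fin nm × Fin nm)) (a b : Fin nm) :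
    relMap σ (withPair L a b) = withPair (relMap σ L) (σ a) (σ b) := by
  ext ⟨x, y⟩
  rw [mem_relMap, mem_withPair, mem_withPair, mem_relMap, Equiv.symm_apply_eq, Equiv.symm_apply_eq, Equiv.symm_apply_eq,
    Equiv.symm_apply_eq]

/-- ★ **tripod pictures are transported by cyclic symmetries.** [cite: KhristoforovSmirnov2021, §2 Lemma 4, proof and Fig. 3 (arXiv v1 p. 4)] -/
theorem TripodPicture.map {σ : Equiv.Perm (Fin nm)} (hσ : IsCyc σ) {α β γ : Fin nm} {L₀ : Finset (Fin nm × Fin nm)}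
    (h : TripodPicture α β γ L₀) : TripodPicture (σ α) (σ β) (σ γ) (relMap σ L₀) where
  ccw := (hσ α β γ).2 h.ccw
  symm a b hab := by rw [mem_relMap] at hab ⊢; exact h.symm _ _ hab
  irrefl a haa := h.irrefl _ (mem_relMap.1 haa)
  off a b hab := by
    rw [mem_relMap] at hab
    obtain ⟨h1, h2, h3⟩ := h.off _ _ hab
    refine ⟨fun e => h1 ?_, fun e => h2 ?_, fun e => h3 ?_⟩ <;> rw [e, Equiv.symm_apply_apply]
  perfect a h1 h2 h3 := by
    have h1' : σ.symm a ≠ α := fun e => h1 (by rw [← e, Equiv.apply_symm_apply])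
    have h2' : σ.symm a ≠ β := fun e => h2 (by rw [← e, Equiv.apply_symm_apply])
    have h3' : σ.symm a ≠ γ := fun e => h3 (by rw [← e, Equiv.apply_symm_apply])
    obtain ⟨b, hb, huniq⟩ := h.perfect _ h1' h2' h3'
    refine ⟨σ b, mem_relMap.2 (by rw [Equiv.symm_apply_apply]; exact hb), fun b' hb' => ?_⟩
    have hb'' : (a, b') ∈ relMap σ _ := hb'
    rw [mem_relMap] at hb''
    rw [← huniq _ hb'', Equiv.apply_symm_apply]
  planar x y z w hxz hyw := by
    rw [← relMap_withPair, ← relMap_withPair, ← relMap_withPair, mem_relMap] at hxz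
    rw [mem_relMap] at hyw
    have key := h.planar _ _ _ _ hxz hyw
    rwa [← hσ.symm.quad x y z w]

/-- **the transported class weight** `(σ·wt) j L := wt (σ j) (σ L)`. [cite: KhristoforovSmirnov2021, §2 Definition 3 and Lemma 4 (arXiv v1 p. 4)] -/
def rotW (σ : Equiv.Perm (Fin nm)) (wt : Fin nm → Finset (Fin nm × Fin nm) → ℂ) : Fin nm → Finset (Fin nm × Fin nm) → ℂ :=
  fun j L => wt (σ j) (relMap σ L)

/-- ★★ **THE TRIPOD LAW IS INVARIANT UNDER CYCLIC SYMMETRIES OF THE MARKS**: if `wt` obeys the tripod law then so does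
`(j, L) ↦ wt (σ j) (σ L)` for every cyclic `σ` — the law is stated in terms of the anticlockwise cyclic order only.
[cite: KhristoforovSmirnov2021, §2 Lemma 4, proof and Fig. 3 (arXiv v1 p. 4); §1.2 (p. 2: cyclic indexing)] -/
theorem tripodLaw_rotW {σ : Equiv.Perm (Fin nm)} (hσ : IsCyc σ) {wt : Fin nm → Finset (Fin nm × Fin nm) → ℂ}
    (h : TripodLaw wt) : TripodLaw (rotW σ wt) := by
  intro α β γ L₀ hP
  unfold rotW
  rw [relMap_withPair, relMap_withPair, relMap_withPair]
  exact h _ _ _ _ (hP.map hσ)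

/-- the transported weight under a composite. [cite: KhristoforovSmirnov2021, §1.2 (arXiv v1 p. 2: counterclockwise cyclic indexing)] -/
theorem rotW_rotW (σ ρ : Equiv.Perm (Fin nm)) (wt : Fin nm → Finset (Fin nm × Fin nm) → ℂ) :
    rotW σ (rotW ρ wt) = rotW (σ.trans ρ) wt := by
  funext j L
  unfold rotW
  rw [relMap_trans]
  rfl

/-- the tripod law is EQUIVALENT to the law for the transported weight. [cite: KhristoforovSmirnov2021, §2 Lemma 4 (arXiv v1 p. 4)] -/
theorem tripodLaw_rotW_iff {σ : Equiv.Perm (Fin nm)} (hσ : IsCyc σ) {wt : Fin nm → Finset (Fin nm × Fin nm) → ℂ} :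
    TripodLaw (rotW σ wt) ↔ TripodLaw wt := by
  refine ⟨fun h => ?_, tripodLaw_rotW hσ⟩
  have key := tripodLaw_rotW hσ.symm h
  rw [rotW_rotW, Equiv.symm_trans_self] at key
  have e : rotW (Equiv.refl (Fin nm)) wt = wt := by funext j L; unfold rotW; rw [relMap_refl]; rfl
  rwa [e] at key

end Transport

/-! ### Consequences: transported tripod-law weights are holomorphic; the rotated fans -/

section RotatedFans

variable {nm : ℕ}

/-- ★ **every transported tripod-law weight gives a discretely holomorphic `k`-disorder observable** on every `k`-marked domain.
[cite: KhristoforovSmirnov2021, §2 Lemma 4 eq. (3) (arXiv v1 p. 4)] -/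
theorem holomorphicW_rotW {σ : Equiv.Perm (Fin nm)} (hσ : IsCyc σ) {wt : Fin nm → Finset (Fin nm × Fin nm) → ℂ} (h : TripodLaw wt)
    (D : TriMarkedDomain nm) : HolomorphicW D (rotW σ wt) :=
  holomorphicW_of_tripodLaw D (tripodLaw_rotW hσ h)

/-- ★ **THE ROTATED FANS OBEY THE TRIPOD LAW**: for `k = 2l+1` marks and every `r`, the weight `(j, L) ↦ fanWt l (j + r) (L + r)` (the fan with apex
arc moved `r` steps clockwise) obeys the tripod law. [cite: KhristoforovSmirnov2021, §2 Lemma 4, proof and Fig. 3 (arXiv v1 p. 4); Remark 6 (p. 5)] -/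
theorem tripodLaw_rotW_fanWt (l r : ℕ) : TripodLaw (rotW (rot (2 * l + 1) ^ r) (fanWt l)) :=
  tripodLaw_rotW (isCyc_rot_pow r) (tripodLaw_fan l)

/-- ★★ hence **the `k` rotations of the fan observable are discretely holomorphic** on every `(2l+1)`-marked domain (HOLO-K's header remark «the fan
(with its rotations)», now a theorem). [cite: KhristoforovSmirnov2021, §2 Lemma 4 eq. (3) (arXiv v1 p. 4); Remark 6 (p. 5)] -/
theorem holomorphicW_rotW_fanWt (l r : ℕ) (D : TriMarkedDomain (2 * l + 1)) : HolomorphicW D (rotW (rot (2 * l + 1) ^ r) (fanWt l)) :=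
  holomorphicW_of_tripodLaw D (tripodLaw_rotW_fanWt l r)

end RotatedFans

end Literature.Probability.Percolation.MarkedLoops

/-! ## The lattice side: rotating the domain -/

namespace Literature.Probability.Percolation.MarkedLoops

open Literature.Probability.Percolation Literature.Probability.LatticeModels
open Literature.Probability.Percolation.FivePoint (side xiDeg XiLinked tau)
open TriMarkedDomain

/-! ### Rotating the domain is rotating the weight -/

section DomainRotation

variable {n : ℕ} (D : TriMarkedDomain (n + 2))

/-- ★ **the link relation of a configuration in the ROTATED domain** is the back-rotated link relation: `u'_a = u_{a+1}`.
[cite: KhristoforovSmirnov2021, §1.2 (arXiv v1 p. 2: cyclic indexing); BollobasRiordan2006, Ch. 7 §7.2.3 p. 197 (re-marking by relabelling; verbatim «follow by relabelling the domain», §7.2.4, proof of Lemma 13)] -/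
theorem linkRel_rotate (ξ : Finset (Sym2 (Site 2))) : linkRel D.rotate ξ = relMap (rot (n + 2)).symm (linkRel D ξ) := by
  ext ⟨a, b⟩
  rw [mem_relMap, Equiv.symm_symm, mem_linkRel, mem_linkRel, rotate_yc, rotate_yc, finRotate_apply, finRotate_apply]
  have e : a + 1 ≠ b + 1 ↔ a ≠ b := not_congr (add_left_injective (1 : Fin (n + 2))).eq_iff
  rw [e]

open Classical in
/-- the weight of a configuration in the rotated domain is the back-rotated weight in the original domain.
[cite: KhristoforovSmirnov2021, §2 Definition 3 (arXiv v1 p. 4); §1.2 (p. 2)] -/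
theorem gkW_rotate (wt : Fin (n + 2) → Finset (Fin (n + 2) × Fin (n + 2)) → ℂ) (v : HexVertex) (i : Fin 3) (s : HexVertex)
    (ξ : Finset (Sym2 (Site 2))) :
    GkW (D := D.rotate) wt v i s ξ = GkW (D := D) (rotW (rot (n + 2)).symm wt) v i s ξ := by
  unfold GkW rotW
  rw [linkRel_rotate]
  rw [← Equiv.sum_comp (rot (n + 2)) (fun j => if InClassX D (faceVertex v (i + 1)) (faceVertex v (i + 2)) s j ξ then
      wt ((rot (n + 2)).symm j) (relMap (rot (n + 2)).symm (linkRel D ξ)) else 0)]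
  refine Finset.sum_congr rfl fun j _ => ?_
  simp only [rotate_inClassX, finRotate_apply, finRotate_symm_apply, add_sub_cancel_right]

/-- ★★ **ROTATING THE DOMAIN IS ROTATING THE WEIGHT**: the class-weighted `k`-disorder observable of `wt` on the rotated domain `D.rotate`
(marks `u'_a = u_{a+1}`) equals the observable of the back-rotated weight `(j, L) ↦ wt (j − 1) (L − 1)` on `D`.
[cite: KhristoforovSmirnov2021, §2 Definition 3 (arXiv v1 p. 4: `u₁, u₂, u₃` in counterclockwise order); BollobasRiordan2006, Ch. 7 §7.2.3 p. 197] -/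
theorem obsW_rotate (wt : Fin (n + 2) → Finset (Fin (n + 2) × Fin (n + 2)) → ℂ) (v : HexVertex) (i : Fin 3) :
    ObsW D.rotate wt v i = ObsW D (rotW (rot (n + 2)).symm wt) v i := by
  unfold ObsW
  rw [rotate_TXb, rotate_TXb]
  simp only [gkW_rotate]

/-- hence **discrete holomorphicity on the rotated domain is holomorphicity of the back-rotated weight.**
[cite: KhristoforovSmirnov2021, §2 Lemma 4 eq. (3) (arXiv v1 p. 4)] -/
theorem holomorphicW_rotate_iff (wt : Fin (n + 2) → Finset (Fin (n + 2) × Fin (n + 2)) → ℂ) :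
    HolomorphicW D.rotate wt ↔ HolomorphicW D (rotW (rot (n + 2)).symm wt) := by
  unfold HolomorphicW
  simp only [rotate_allSides, obsW_rotate]

end DomainRotation

end Literature.Probability.Percolation.MarkedLoops
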